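import Mathlib.GroupTheory.SemidirectProduct
import Mathlib.GroupTheory.Subgroup.Center
import Mathlib.Algebra.Group.End
import Mathlib.Topology.Algebra.Group.Basic

/-!
# The cyclotomic envelope of an augmented group ([EtTh] §2, Definition 2.10)

Mochizuki, *The Étale Theta Function and its Frobenioid-theoretic Manifestations*,
Publ. RIMS 45 (2009) [EtTh], §2 "The Theory of Theta Environments", PRIMS text pp.44, 47, 49
(locators `p.N` = PDF pages of the PRIMS text, bib key `MochizukiEtTh2009`).

Pure group theory, built on Mathlib's `SemidirectProduct`:

* `innerAut`, `Out`, `contMulAut`, `TopOut` — inner / outer automorphism groups of a (topological)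
  group, the ambient objects of "`D_Y ⊆ Out(Π^tp_Y[μ_N])`" (Def 2.13).
* `CycEnvelope aug χ` — the cyclotomic envelope `Π[μ_N] := Π ×_{G_K} (Δ_{μ_N} ⋊ G_K)` of an
  augmented group `aug : Π ↠ G_K` with respect to a `G_K`-action `χ` on an abelian group `μ`
  (= `Δ_{μ_N} = ℤ/Nℤ(1)`), realised as the semidirect product `μ ⋊[χ ∘ aug] Π`; the fibre-product
  description of the text is PROVED (`CycEnvelope.equivFiber`).
* `CycEnvelope.algSection` — the tautological ("algebraic") section `s^alg_Π : Π → Π[μ_N]`.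
* `CycEnvelope.deltaEnv` — `Δ[μ_N] := Ker(Π[μ_N] ↠ G_K)`, PROVED equal to `Δ × Δ_{μ_N}`
  (`CycEnvelope.prodEquivDeltaEnv`).
* `CycEnvelope.muConjClass` — "`μ_N`-conjugacy classes" of subgroups.
* `CycEnvelope.shift` — the automorphism of `Π[μ_N]` obtained by "shifting" by a `μ`-valued
  1-cocycle (Prop 2.14 (ii)); conjugation by `μ_N` = shifting by a coboundary (p.47), PROVED.
* Prop 2.11 (i) (`Ker(Δ[μ_N] ↠ Δ) = Z(Δ[μ_N])`) PROVED from centre-freeness of `Δ`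
  (the text derives it from temp-slimness, [SemiAnbd] Ex. 3.10).

Design: `Π` is a reserved token in Lean 4, so the augmented group is called `P`; `μ` is written
multiplicatively. Prop 2.11 (ii) (kernel of `Π[μ_N] ↠ Π` = union of centralisers of open
subgroups) involves the topology of `Π[μ_N]` and is NOT in this file.
-/

namespace Literature.AnabelianGeometry.EtaleTheta

/-! ## Inner and outer automorphism groups -/

section Outer

variable (G : Type*) [Group G]

/-- The subgroup `Inn(G) ⊆ Aut(G)` of inner automorphisms (range of `MulAut.conj`).
[cite: MochizukiEtTh2009, Def 2.13(i) p.47] -/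
abbrev innerAut : Subgroup (MulAut G) := (MulAut.conj : G →* MulAut G).range

/-- `Inn(G)` is normal in `Aut(G)`: `φ ∘ conj(g) ∘ φ⁻¹ = conj(φ g)`.
[cite: MochizukiEtTh2009, Def 2.13(i) p.47] -/
instance innerAut_normal : (innerAut G).Normal where
  conj_mem := by
    rintro _ ⟨g, rfl⟩ φ
    refine ⟨φ g, ?_⟩
    ext h
    simp [MulAut.conj_apply, mul_assoc]

/-- The outer automorphism group `Out(G) := Aut(G)/Inn(G)` of an abstract group.
[cite: MochizukiEtTh2009, Def 2.13(i) p.47] -/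
abbrev Out : Type _ := MulAut G ⧸ innerAut G

variable [TopologicalSpace G]

/-- The subgroup of `Aut(G)` of bi-continuous automorphisms of a topological group `G`
("automorphisms of the topological group `G`"). [cite: MochizukiEtTh2009, Def 2.13(i) p.47] -/
def contMulAut : Subgroup (MulAut G) where
  carrier := {φ | Continuous φ ∧ Continuous φ.symm}
  mul_mem' := by
    rintro φ ψ ⟨h1, h2⟩ ⟨h3, h4⟩
    exact ⟨h1.comp h3, h4.comp h2⟩
  one_mem' := ⟨continuous_id, continuous_id⟩
  inv_mem' := by
    rintro φ ⟨h1, h2⟩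
    exact ⟨h2, h1⟩

/-- Membership in `contMulAut`. [cite: MochizukiEtTh2009, Def 2.13(i) p.47] -/
theorem mem_contMulAut {φ : MulAut G} :
    φ ∈ contMulAut G ↔ Continuous φ ∧ Continuous φ.symm := Iff.rfl

/-- Inner automorphisms of a topological group are bi-continuous.
[cite: MochizukiEtTh2009, Def 2.13(i) p.47] -/
theorem innerAut_le_contMulAut [IsTopologicalGroup G] : innerAut G ≤ contMulAut G := by
  rintro _ ⟨g, rfl⟩
  refine ⟨?_, ?_⟩
  · change Continuous fun h => MulAut.conj g h
    simp only [MulAut.conj_apply]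
    fun_prop
  · change Continuous fun h => (MulAut.conj g).symm h
    simp only [MulAut.conj_symm_apply]
    fun_prop

/-- The (normal) subgroup of inner automorphisms inside the bi-continuous automorphisms.
[cite: MochizukiEtTh2009, Def 2.13(i) p.47] -/
abbrev innerContAut : Subgroup (contMulAut G) := (innerAut G).subgroupOf (contMulAut G)

/-- Normality of `innerContAut`. [cite: MochizukiEtTh2009, Def 2.13(i) p.47] -/
instance innerContAut_normal : (innerContAut G).Normal :=
  (innerAut_normal G).subgroupOf _

/-- The outer automorphism group `Out(G)` of a TOPOLOGICAL group: bi-continuous automorphisms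
modulo inner ones — the ambient group of `D_Y ⊆ Out(Π^tp_Y[μ_N])` in Def 2.13 (i).
[cite: MochizukiEtTh2009, Def 2.13(i) p.47] -/
abbrev TopOut : Type _ := contMulAut G ⧸ innerContAut G

/-- The projection `Aut_top(G) → Out(G)`. [cite: MochizukiEtTh2009, Def 2.13(i) p.47] -/
abbrev TopOut.mk : contMulAut G →* TopOut G := QuotientGroup.mk' _

end Outer

/-! ## The cyclotomic envelope (Definition 2.10) -/

section Envelope

variable {P G μ : Type*} [Group P] [Group G] [CommGroup μ]

/-- `Π_{μ_N,K} := Δ_{μ_N} ⋊ G_K`, the semidirect product of the cyclotome `Δ_{μ_N} = ℤ/Nℤ(1)`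
(here: an abstract abelian group `μ` with `G`-action `χ`) by `G_K`.
[cite: MochizukiEtTh2009, p.44] -/
abbrev CycSemidirect (χ : G →* MulAut μ) : Type _ := μ ⋊[χ] G

/-- **Definition 2.10**, the cyclotomic envelope `Π[μ_N] := Π ×_{G_K} Π_{μ_N,K}` of an augmented
group `aug : Π → G_K`, realised as `μ ⋊[χ ∘ aug] Π` (PROVED isomorphic to the fibre product in
`CycEnvelope.equivFiber`). [cite: MochizukiEtTh2009, Def 2.10 p.44] -/
abbrev CycEnvelope (aug : P →* G) (χ : G →* MulAut μ) : Type _ := μ ⋊[χ.comp aug] P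

namespace CycEnvelope

variable (aug : P →* G) (χ : G →* MulAut μ)

/-- The natural surjection `Π[μ_N] ↠ Π`. [cite: MochizukiEtTh2009, Def 2.10 p.44] -/
abbrev proj : CycEnvelope aug χ →* P := SemidirectProduct.rightHom

/-- The augmentation `Π[μ_N] ↠ G_K`. [cite: MochizukiEtTh2009, Def 2.10 p.44] -/
abbrev toG : CycEnvelope aug χ →* G := aug.comp (proj aug χ)

/-- The inclusion of the cyclotome `Δ_{μ_N} ↪ Π[μ_N]` (kernel of `proj`).
[cite: MochizukiEtTh2009, Def 2.10 p.44] -/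
abbrev inMu : μ →* CycEnvelope aug χ := SemidirectProduct.inl

/-- The tautological section `s^alg_Π : Π → Π[μ_N]` of `Π[μ_N] ↠ Π`, "which we shall also call
tautological" (later: the *algebraic section*, Def 2.13 (i)).
[cite: MochizukiEtTh2009, Def 2.10 p.44] -/
abbrev algSection : P →* CycEnvelope aug χ := SemidirectProduct.inr

/-- `s^alg_Π` is a section of `Π[μ_N] ↠ Π`. [cite: MochizukiEtTh2009, Def 2.10 p.44] -/
theorem proj_comp_algSection : (proj aug χ).comp (algSection aug χ) = MonoidHom.id P :=
  SemidirectProduct.rightHom_comp_inr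

/-- `proj` is surjective. [cite: MochizukiEtTh2009, Def 2.10 p.44] -/
theorem proj_surjective : Function.Surjective (proj aug χ) :=
  SemidirectProduct.rightHom_surjective

/-- The kernel of `Π[μ_N] ↠ Π` is the cyclotome `μ_N`. [cite: MochizukiEtTh2009, Def 2.10 p.44] -/
theorem ker_proj_eq_range_inMu : (proj aug χ).ker = (inMu aug χ).range :=
  SemidirectProduct.range_inl_eq_ker_rightHom.symm

/-- The fibre product `Π ×_{G_K} (μ ⋊ G_K)` as a subgroup of `Π × (μ ⋊ G_K)`.
[cite: MochizukiEtTh2009, Def 2.10 p.44] -/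
def fiberProd : Subgroup (P × CycSemidirect χ) where
  carrier := {x | aug x.1 = SemidirectProduct.rightHom x.2}
  mul_mem' := by
    rintro ⟨a, b⟩ ⟨c, d⟩ (h1 : aug a = _) (h2 : aug c = _)
    change aug (a * c) = SemidirectProduct.rightHom (b * d)
    rw [map_mul, map_mul, h1, h2]
  one_mem' := by
    change aug 1 = SemidirectProduct.rightHom 1
    simp
  inv_mem' := by
    rintro ⟨a, b⟩ (h : aug a = _)
    change aug a⁻¹ = SemidirectProduct.rightHom b⁻¹
    rw [map_inv, map_inv, h]

/-- The map `Π[μ_N] → Π × (μ ⋊ G_K)`, `(a, g) ↦ (g, (a, aug g))`.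
[cite: MochizukiEtTh2009, Def 2.10 p.44] -/
def toFiber : CycEnvelope aug χ →* P × CycSemidirect χ :=
  (proj aug χ).prod (SemidirectProduct.map (MonoidHom.id μ) aug (fun _ => rfl))

/-- `toFiber` in coordinates. [cite: MochizukiEtTh2009, Def 2.10 p.44] -/
@[simp] theorem toFiber_apply (x : CycEnvelope aug χ) :
    toFiber aug χ x = (x.right, ⟨x.left, aug x.right⟩) := rfl

/-- **Definition 2.10, fibre-product description**: `μ ⋊[χ ∘ aug] Π ≃* Π ×_{G_K} (μ ⋊[χ] G_K)`.
[cite: MochizukiEtTh2009, Def 2.10 p.44] -/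
noncomputable def equivFiber : CycEnvelope aug χ ≃* fiberProd aug χ :=
  MulEquiv.ofBijective ((toFiber aug χ).codRestrict (fiberProd aug χ) (fun x => by
    change aug x.right = _; simp)) (by
    constructor
    · intro x y h
      have h' := congrArg Subtype.val h
      simp only [MonoidHom.codRestrict_apply, toFiber_apply, Prod.mk.injEq] at h'
      obtain ⟨h1, h2⟩ := h'
      have h3 := congrArg SemidirectProduct.left h2
      ext
      · exact h3
      · exact h1
    · rintro ⟨⟨g, ⟨a, t⟩⟩, (hx : aug g = t)⟩
      refine ⟨⟨a, g⟩, Subtype.ext ?_⟩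
      simp [hx])

/-- `Δ[μ_N] := Ker(Π[μ_N] ↠ G_K)`. [cite: MochizukiEtTh2009, Def 2.10 p.44] -/
abbrev deltaEnv : Subgroup (CycEnvelope aug χ) := (toG aug χ).ker

/-- Membership in `Δ[μ_N]`: `(a, g) ∈ Δ[μ_N] ↔ g ∈ Δ := Ker(aug)`.
[cite: MochizukiEtTh2009, Def 2.10 p.44] -/
theorem mem_deltaEnv_iff (x : CycEnvelope aug χ) : x ∈ deltaEnv aug χ ↔ x.right ∈ aug.ker := by
  simp [deltaEnv, toG, MonoidHom.mem_ker]

/-- The map `μ × Δ → Π[μ_N]`, `(a, d) ↦ (a, d)`; a homomorphism because `Δ` acts trivially on `μ`.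
[cite: MochizukiEtTh2009, Def 2.10 p.44] -/
def prodToEnv : μ × aug.ker →* CycEnvelope aug χ where
  toFun x := ⟨x.1, (x.2 : P)⟩
  map_one' := rfl
  map_mul' := by
    rintro ⟨a, ⟨d, hd⟩⟩ ⟨b, ⟨e, he⟩⟩
    rw [MonoidHom.mem_ker] at hd
    ext
    · simp [hd]
    · simp

/-- **"`Δ[μ_N] = Δ × Δ_{μ_N}`"** (Def 2.10): the map `μ × Δ → Π[μ_N]` is an isomorphism onto
`Δ[μ_N]`. [cite: MochizukiEtTh2009, Def 2.10 p.44] -/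
noncomputable def prodEquivDeltaEnv : μ × aug.ker ≃* deltaEnv aug χ :=
  MulEquiv.ofBijective ((prodToEnv aug χ).codRestrict (deltaEnv aug χ) (fun x => by
    rw [mem_deltaEnv_iff]; exact x.2.2)) (by
    constructor
    · rintro ⟨a, ⟨d, hd⟩⟩ ⟨b, ⟨e, he⟩⟩ h
      have h' := congrArg Subtype.val h
      simp only [MonoidHom.codRestrict_apply] at h'
      have h1 := congrArg SemidirectProduct.left h'
      have h2 := congrArg SemidirectProduct.right h'
      simp only [prodToEnv, MonoidHom.coe_mk, OneHom.coe_mk] at h1 h2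
      subst h1; subst h2; rfl
    · rintro ⟨x, hx⟩
      rw [mem_deltaEnv_iff] at hx
      exact ⟨⟨x.left, ⟨x.right, hx⟩⟩, rfl⟩)

/-- A "`μ_N`-conjugacy class" of subgroups of `Π[μ_N]`: the orbit of a subgroup under conjugation by
elements of the cyclotome `μ_N ⊆ Π[μ_N]`. [cite: MochizukiEtTh2009, Def 2.10 p.44] -/
def muConjClass (H : Subgroup (CycEnvelope aug χ)) : Set (Subgroup (CycEnvelope aug χ)) :=
  {K | ∃ a : μ, K = H.map (MulAut.conj (inMu aug χ a)).toMonoidHom}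

/-- A subgroup lies in its own `μ_N`-conjugacy class. [cite: MochizukiEtTh2009, Def 2.10 p.44] -/
theorem self_mem_muConjClass (H : Subgroup (CycEnvelope aug χ)) : H ∈ muConjClass aug χ H := by
  refine ⟨1, ?_⟩
  rw [map_one]
  ext x
  simp

/-! ### Cocycle shifts (Proposition 2.14 (ii)) and `μ_N`-conjugation (p.47) -/

/-- A (multiplicative) 1-cocycle `δ : Π → μ_N` for the action `χ ∘ aug`:
`δ(gh) = δ(g) · (g · δ(h))`. [cite: MochizukiEtTh2009, Prop 2.14(ii) p.49] -/
def IsEnvCocycle (δ : P → μ) : Prop := ∀ g h : P, δ (g * h) = δ g * χ (aug g) (δ h)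

/-- The coboundary `g ↦ c · (g·c)⁻¹` of an element `c ∈ μ_N`.
[cite: MochizukiEtTh2009, p.47] -/
def coboundary (c : μ) : P → μ := fun g => c * (χ (aug g) c)⁻¹

/-- Coboundaries are cocycles. [cite: MochizukiEtTh2009, p.47] -/
theorem isEnvCocycle_coboundary (c : μ) : IsEnvCocycle aug χ (coboundary aug χ c) := by
  intro g h
  simp only [coboundary, map_mul, MulAut.mul_apply, map_inv, mul_assoc]
  rw [inv_mul_cancel_left]

variable {aug χ} in
/-- The automorphism `α_δ` of `Π[μ_N]` obtained by "shifting" by a 1-cocycle `δ`: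
`(a, g) ↦ (a · δ(g), g)`. [cite: MochizukiEtTh2009, Prop 2.14(ii) p.49] -/
def shift {δ : P → μ} (hδ : IsEnvCocycle aug χ δ) : MulAut (CycEnvelope aug χ) where
  toFun x := ⟨x.left * δ x.right, x.right⟩
  invFun x := ⟨x.left * (δ x.right)⁻¹, x.right⟩
  left_inv x := by ext <;> simp
  right_inv x := by ext <;> simp
  map_mul' x y := by
    ext
    · simp only [SemidirectProduct.mul_left, SemidirectProduct.mul_right, MonoidHom.coe_comp,
        Function.comp_apply, map_mul, hδ x.right y.right]
      simp only [mul_assoc, mul_left_comm]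
    · simp

variable {aug χ} in
/-- `α_δ` induces the identity on the quotient `Π[μ_N] ↠ Π`.
[cite: MochizukiEtTh2009, Prop 2.14(ii) p.49] -/
theorem proj_shift {δ : P → μ} (hδ : IsEnvCocycle aug χ δ) (x : CycEnvelope aug χ) :
    proj aug χ (shift hδ x) = proj aug χ x := rfl

variable {aug χ} in
/-- `α_δ` induces the identity on the kernel `μ_N` of `Π[μ_N] ↠ Π` (a cocycle vanishes at `1`).
[cite: MochizukiEtTh2009, Prop 2.14(ii) p.49] -/
theorem shift_inMu {δ : P → μ} (hδ : IsEnvCocycle aug χ δ) (a : μ) :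
    shift hδ (inMu aug χ a) = inMu aug χ a := by
  have h1 : δ 1 = 1 := by
    have := hδ 1 1
    simp only [mul_one, map_one, MulAut.one_apply] at this
    exact mul_eq_left.mp this.symm
  ext <;> simp [shift, h1]

/-- **"Conjugation by an element of `μ_N` corresponds precisely to modifying a cocycle by a
coboundary"** (p.47): `conj(c) = α_{δ_c}` with `δ_c(g) = c · (g·c)⁻¹`.
[cite: MochizukiEtTh2009, p.47] -/
theorem conj_inMu_eq_shift_coboundary (c : μ) (x : CycEnvelope aug χ) :
    MulAut.conj (inMu aug χ c) x = shift (isEnvCocycle_coboundary aug χ c) x := by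
  rw [MulAut.conj_apply]
  ext
  · simp only [shift, coboundary, MulEquiv.coe_mk, Equiv.coe_fn_mk, SemidirectProduct.mul_left,
      SemidirectProduct.left_inl, SemidirectProduct.right_inl,
      SemidirectProduct.inv_left, MonoidHom.coe_comp, Function.comp_apply, map_one,
      inv_one, MulAut.one_apply, map_inv, mul_assoc]
    exact mul_left_comm _ _ _
  · simp [shift]

/-! ### Proposition 2.11 (i): the kernel of `Δ[μ_N] ↠ Δ` is the centre of `Δ[μ_N]` -/

/-- Two elements of `Δ[μ_N]` commute iff their images in `Δ` commute (the cyclotome is central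
in `Δ[μ_N] = μ × Δ`). [cite: MochizukiEtTh2009, Prop 2.11(i) p.44] -/
theorem commute_iff_of_mem_deltaEnv {x y : CycEnvelope aug χ} (hx : x ∈ deltaEnv aug χ)
    (hy : y ∈ deltaEnv aug χ) : x * y = y * x ↔ x.right * y.right = y.right * x.right := by
  rw [mem_deltaEnv_iff, MonoidHom.mem_ker] at hx hy
  constructor
  · intro h
    exact congrArg SemidirectProduct.right h
  · intro h
    ext
    · simp [hx, hy, mul_comm]
    · simpa using h

/-- **Proposition 2.11 (i)** (General Properties of the Cyclotomic Envelope): if `Δ = Ker(aug)` is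
centre-free (e.g. temp-slim, [SemiAnbd] Ex. 3.10), then an element of `Δ[μ_N]` is central in
`Δ[μ_N]` iff it lies in the kernel `μ_N` of `Δ[μ_N] ↠ Δ`.
[cite: MochizukiEtTh2009, Prop 2.11(i) p.44] -/
theorem central_in_deltaEnv_iff (hΔ : ∀ d ∈ aug.ker, (∀ e ∈ aug.ker, d * e = e * d) → d = 1)
    {z : CycEnvelope aug χ} (hz : z ∈ deltaEnv aug χ) :
    (∀ w ∈ deltaEnv aug χ, z * w = w * z) ↔ proj aug χ z = 1 := by
  constructor
  · intro h
    have hzr : z.right ∈ aug.ker := (mem_deltaEnv_iff aug χ z).mp hz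
    refine hΔ z.right hzr fun e he => ?_
    have hw : (⟨1, e⟩ : CycEnvelope aug χ) ∈ deltaEnv aug χ := by
      rw [mem_deltaEnv_iff]; exact he
    have := (commute_iff_of_mem_deltaEnv aug χ hz hw).mp (h _ hw)
    simpa using this
  · intro h w hw
    rw [commute_iff_of_mem_deltaEnv aug χ hz hw]
    change z.right = 1 at h
    simp [h]

/-- **Proposition 2.11 (i)**, subgroup form: `Z(Δ[μ_N]) = Ker(Δ[μ_N] ↠ Δ)` (as subgroups of the
group `Δ[μ_N]`), for centre-free `Δ`. [cite: MochizukiEtTh2009, Prop 2.11(i) p.44] -/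
theorem center_deltaEnv_eq (hΔ : ∀ d ∈ aug.ker, (∀ e ∈ aug.ker, d * e = e * d) → d = 1) :
    Subgroup.center (deltaEnv aug χ) = ((proj aug χ).ker).subgroupOf (deltaEnv aug χ) := by
  ext ⟨z, hz⟩
  rw [Subgroup.mem_center_iff, Subgroup.mem_subgroupOf, MonoidHom.mem_ker]
  change (∀ w : deltaEnv aug χ, w * ⟨z, hz⟩ = ⟨z, hz⟩ * w) ↔ proj aug χ z = 1
  rw [← central_in_deltaEnv_iff aug χ hΔ hz]
  constructor
  · intro h w hw
    have := congrArg Subtype.val (h ⟨w, hw⟩)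
    exact this.symm
  · intro h w
    exact Subtype.ext (h w w.2).symm

/-- An isomorphism of groups carries the centre onto the centre (used for Prop 2.11 (i)).
[cite: MochizukiEtTh2009, Prop 2.11(i) p.44] -/
theorem map_center_eq_of_equiv {A B : Type*} [Group A] [Group B] (e : A ≃* B) :
    (Subgroup.center A).map e.toMonoidHom = Subgroup.center B := by
  ext y
  constructor
  · rintro ⟨x, hx, rfl⟩
    rw [SetLike.mem_coe, Subgroup.mem_center_iff] at hx
    rw [Subgroup.mem_center_iff]
    intro b
    obtain ⟨a, rfl⟩ := e.surjective b
    change e a * e x = e x * e a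
    rw [← map_mul, ← map_mul, hx a]
  · intro hy
    refine ⟨e.symm y, ?_, by simp⟩
    rw [Subgroup.mem_center_iff] at hy
    rw [SetLike.mem_coe, Subgroup.mem_center_iff]
    intro a
    apply e.injective
    rw [map_mul, map_mul, MulEquiv.apply_symm_apply]
    exact hy (e a)

/-- **Proposition 2.11 (i), "in particular"**: any isomorphism of groups `Δ_α[μ_N] ≃ Δ_β[μ_N]`
is compatible with the surjections `Δ_∘[μ_N] ↠ Δ_∘`, i.e. carries the kernel `μ_N` onto the
kernel `μ_N` (both being the centre). [cite: MochizukiEtTh2009, Prop 2.11(i) p.44] -/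
theorem map_equiv_ker_eq {P' G' μ' : Type*} [Group P'] [Group G'] [CommGroup μ']
    (aug' : P' →* G') (χ' : G' →* MulAut μ')
    (hΔ : ∀ d ∈ aug.ker, (∀ e ∈ aug.ker, d * e = e * d) → d = 1)
    (hΔ' : ∀ d ∈ aug'.ker, (∀ e ∈ aug'.ker, d * e = e * d) → d = 1)
    (e : deltaEnv aug χ ≃* deltaEnv aug' χ') :
    (((proj aug χ).ker).subgroupOf (deltaEnv aug χ)).map e.toMonoidHom =
      ((proj aug' χ').ker).subgroupOf (deltaEnv aug' χ') := by
  rw [← center_deltaEnv_eq aug χ hΔ, ← center_deltaEnv_eq aug' χ' hΔ']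
  exact map_center_eq_of_equiv e

end CycEnvelope

end Envelope

end Literature.AnabelianGeometry.EtaleTheta
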